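import Summits.Ventures.Crystal3D.Theorems.StickyWulffConstantGenericWallFloorMultiStarCount
import HarnessLib

/-!
# Pairwise-covering families of small sets: `|N| + k ≤ 12` (finite combinatorics for the k-fold-top census)

HONEST FRAMING. Part of the venture `Summits/Ventures/Crystal3D` (cell `crystal3d-full`), helper for the crux
`CoaxialWallLaw` (stmt-Ventures-19481) of `route-Ventures-StickyWulffConstant`, REGISTERED line `WallLedgerF`
(planner cf-p1 gen 16), open stub `stub_coaxialTwoSlabAdhesion` (general fillings).  Rung credit only; F-C1 not
moved.  Pure finite combinatorics, the `≤ 5` version of 19480-p2's `card_add_card_le_twelve` (`…MultiStarCount`,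
which needs sets of size EXACTLY `5`): it lets the k-fold-top census of the exact end accounting (`KFoldTopDeficit` /
`KFoldTopGlide`, `…KFoldTop`, `…KFoldTopSplit`) be reduced to PAIRWISE covering statements with arrival stars
`{predecessor} ∪ (common neighbours)` whose size is only bounded ABOVE by `5` (no slot enumeration needed).

**Theorem (`card_add_card_le_twelve_of_card_le_five`).**  `N` a finite set with `|N| ≤ 11`, `𝒮` a finite family
of subsets of `N` of size `≤ 5` any two distinct members of which COVER `N`.  Then `|N| + |𝒮| ≤ 12`.
Proof: for `|𝒮| ≥ 2` every point of `N` is missed by at most one member, so the complements `N ∖ S` are pairwise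
disjoint: `Σ_S (|N| − |S|) ≤ |N|` gives `(k − 1)|N| ≤ 5k`, and distinct members have distinct complements, at most
one of them empty, so `k − 1 ≤ |N|`; the two inequalities give `|N| + k ≤ 12`.

WHAT THIS IS NOT: no geometry; not the stub; F-C1 not moved.
-/

namespace Summit.Ventures.Crystal3D.Theorems

open Finset

/-- **Pairwise-covering subsets of size `≤ 5`.**  See the module docstring. -/
theorem card_add_card_le_twelve_of_card_le_five {α : Type*} [DecidableEq α] (N : Finset α) (𝒮 : Finset (Finset α))
    (hN : N.card ≤ 11) (hsub : ∀ S ∈ 𝒮, S ⊆ N) (hcard : ∀ S ∈ 𝒮, S.card ≤ 5)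
    (hcov : ∀ S ∈ 𝒮, ∀ S' ∈ 𝒮, S ≠ S' → N ⊆ S ∪ S') : N.card + 𝒮.card ≤ 12 := by
  by_cases h1 : 𝒮.card ≤ 1
  · omega
  -- the complements are pairwise disjoint
  have hdisj : ∀ S ∈ 𝒮, ∀ S' ∈ 𝒮, S ≠ S' → Disjoint (N \ S) (N \ S') := by
    intro S hS S' hS' hSS'
    rw [Finset.disjoint_left]
    intro x hx hx'
    rw [Finset.mem_sdiff] at hx hx'
    have := hcov S hS S' hS' hSS' hx.1
    rw [Finset.mem_union] at this
    rcases this with h | h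
    · exact hx.2 h
    · exact hx'.2 h
  have hsum : ∑ S ∈ 𝒮, (N \ S).card ≤ N.card := by
    rw [← Finset.card_biUnion hdisj]
    exact Finset.card_le_card (Finset.biUnion_subset.2 fun S _ => Finset.sdiff_subset)
  -- (a) sizes: `Σ (|N| − |S|) ≥ k (|N| − 5)`
  have hsum_ge : 𝒮.card * (N.card - 5) ≤ ∑ S ∈ 𝒮, (N \ S).card := by
    have : ∑ S ∈ 𝒮, (N.card - 5) ≤ ∑ S ∈ 𝒮, (N \ S).card :=
      Finset.sum_le_sum fun S hS => by
        rw [Finset.card_sdiff_of_subset (hsub S hS)]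
        have := hcard S hS
        omega
    rwa [Finset.sum_const, smul_eq_mul] at this
  -- (b) distinctness: at most one complement is empty, so `k − 1 ≤ Σ |N \ S|`
  have hsum_ge' : 𝒮.card - 1 ≤ ∑ S ∈ 𝒮, (N \ S).card := by
    -- the members with empty complement are all equal to `N`
    have hemp : (𝒮.filter fun S => (N \ S).card = 0).card ≤ 1 := by
      refine Finset.card_le_one.2 fun S hS S' hS' => ?_
      obtain ⟨hS, h0⟩ := Finset.mem_filter.1 hS
      obtain ⟨hS', h0'⟩ := Finset.mem_filter.1 hS'
      have e : S = N := Finset.Subset.antisymm (hsub S hS)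
        (by rw [Finset.card_eq_zero, Finset.sdiff_eq_empty_iff_subset] at h0; exact h0)
      have e' : S' = N := Finset.Subset.antisymm (hsub S' hS')
        (by rw [Finset.card_eq_zero, Finset.sdiff_eq_empty_iff_subset] at h0'; exact h0')
      rw [e, e']
    have hsplit := Finset.card_filter_add_card_filter_not (s := 𝒮) (fun S => (N \ S).card = 0)
    have hpos : (𝒮.filter fun S => ¬ (N \ S).card = 0).card ≤ ∑ S ∈ 𝒮, (N \ S).card := by
      calc (𝒮.filter fun S => ¬ (N \ S).card = 0).card
          = ∑ S ∈ 𝒮.filter (fun S => ¬ (N \ S).card = 0), 1 := by rw [Finset.sum_const, smul_eq_mul, mul_one]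
        _ ≤ ∑ S ∈ 𝒮.filter (fun S => ¬ (N \ S).card = 0), (N \ S).card :=
            Finset.sum_le_sum fun S hS => by have := (Finset.mem_filter.1 hS).2; omega
        _ ≤ ∑ S ∈ 𝒮, (N \ S).card := Finset.sum_le_sum_of_subset (Finset.filter_subset _ _)
    omega
  -- (c) two members cover: `|N| ≤ 10`
  obtain ⟨S₁, hS₁, S₂, hS₂, hne⟩ := Finset.one_lt_card.1 (show 1 < 𝒮.card by omega)
  have hN10 : N.card ≤ 10 := by
    have := (Finset.card_le_card (hcov S₁ hS₁ S₂ hS₂ hne)).trans (Finset.card_union_le _ _)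
    have h5 := hcard S₁ hS₁; have h5' := hcard S₂ hS₂
    omega
  -- arithmetic: `k (|N| − 5) ≤ |N|`, `k − 1 ≤ |N|`, `|N| ≤ 10`
  have hA : 𝒮.card * (N.card - 5) ≤ N.card := hsum_ge.trans hsum
  have hB : 𝒮.card - 1 ≤ N.card := hsum_ge'.trans hsum
  have hk : 𝒮.card ≤ 11 := by omega
  interval_cases hcN : N.card <;> interval_cases hck : 𝒮.card <;> omega

end Summit.Ventures.Crystal3D.Theorems
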